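import Literature.Probability.RandomPlanarGeometry.HydrodynamicCapacityDisplacement
import Literature.Probability.RandomPlanarGeometry.HullHeightBound
import Mathlib.Analysis.Complex.Liouville
import HarnessLib

/-!
# High points keep their height under `g_K`: `Im g_K(z) ≥ Im z - 2 hcap(K)/Im z`, and `g_K' ≈ 1`

Topic `Literature/Probability/RandomPlanarGeometry`; theorems only. For a bounded hull `K ∈ 𝒬`
(`IsBoundedHull`) with hydrodynamic map `g : ℍ ∖ K → ℍ` (`IsHydrodynamicMap`) and capacity
`a = hcap(K)`, the capacity displacement bound of `HydrodynamicCapacityDisplacement.lean`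
(`|g(z) - z|² Im g(z) ≤ a (Im z - Im g(z))`) and the height bound of `HullHeightBound.lean`
(`(Im w)² ≤ 2a` on `K`, Kemppainen–Smirnov Lemma A.13) give, for points above the hull:

* `IsHydrodynamicMap.half_im_lt_im_of_four_mul_hcap_lt` — **`Im g(z) > Im z/2` whenever
  `4a < (Im z)²`**: the drop `d = Im z - Im g(z)` and the height `m = Im g(z)` satisfy `d m ≤ a`
  and `d + m = Im z`, so `d ≠ m` on the half-plane `{Im > 2√a} ⊆ ℍ ∖ K`, which is connected and
  on which `d < m` far up;
* `IsHydrodynamicMap.im_sub_le_im` — hence **`Im z - 2a/Im z ≤ Im g(z)`** there (the general-hull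
  form of `(Im g_t)² ≥ (Im z)² - 4t` for Loewner chains, `Loewner.im_sq_sub_le_im_map_sq`), and
  `|g(z) - z| ≤ 2a/Im z` (`norm_sub_self_le_two_mul_hcap_div_im`);
* `IsHydrodynamicMap.norm_deriv_sub_one_le` — **`|g'(z) - 1| ≤ 11 a/(Im z)²` for `16 a ≤ (Im z)²`**
  (Cauchy's estimate for `g - id` on `B(z, Im z/4)`), and `|log |g'(z)|| ≤ 22 a/(Im z)²` for
  `32 a ≤ (Im z)²` (`abs_log_norm_deriv_le`).

These are the "inner map" inputs (displacement, height, derivative) with which the hull of a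
lattice past of small capacity but arbitrary diameter is compared with a short Loewner flow.

## References

* G. F. Lawler, *Conformally Invariant Processes in the Plane*, AMS (2005), §3.4 (Prop. 3.36,
  (3.7)), §4.1 Thm. 4.6 [Lawler2005].
* A. Kemppainen, S. Smirnov, Ann. Probab. 45 (2017), App. A Lemma A.13 [KemppainenSmirnov2017].
-/

noncomputable section

open Set Filter Topology Metric Bornology Complex
open UpperHalfPlane (upperHalfPlaneSet isOpen_upperHalfPlaneSet)

namespace Literature.Probability.RandomPlanarGeometry

namespace IsHydrodynamicMap

variable {K : Set ℂ} {φ : ConformalEquiv (upperHalfPlaneSet \ K) upperHalfPlaneSet}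

/-- Points with `2 hcap < (Im z)²` are off a bounded hull (height bound `(Im)² ≤ 2 hcap` on `K`).
[cite: KemppainenSmirnov2017, App. A Lemma A.13] -/
theorem mem_diff_of_two_mul_hcap_lt (hK : IsBoundedHull K) (hφ : IsHydrodynamicMap K φ) {z : ℂ}
    (hzi : 0 < z.im) (hz : 2 * hcap K φ < z.im ^ 2) : z ∈ upperHalfPlaneSet \ K :=
  ⟨hzi, fun hzK ↦ (hK.im_sq_le_two_mul_hcap hzK hzi hφ).not_gt hz⟩

/-- **The drop times the height is at most the capacity**: `(Im z - Im g(z)) · Im g(z) ≤ hcap`.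
[cite: Lawler2005, §3.4 Prop. 3.36] -/
theorem sub_im_mul_im_le_hcap (hφ : IsHydrodynamicMap K φ) (hb : IsBounded (K ∩ upperHalfPlaneSet))
    {z : ℂ} (hz : z ∈ upperHalfPlaneSet \ K) :
    (z.im - (φ z).im) * (φ z).im ≤ hcap K φ := by
  have h := hφ.norm_sub_self_sq_mul_im_le hb hz
  have hcap0 : 0 ≤ hcap K φ := hφ.hcap_nonneg hb
  have him : 0 < (φ z).im := im_pos hz
  have hd0 : 0 ≤ z.im - (φ z).im := by linarith [hφ.im_le hb hz]
  have hd : z.im - (φ z).im ≤ ‖φ z - z‖ := by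
    have h1 := neg_abs_le (φ z - z).im
    have h2 := abs_im_le_norm (φ z - z)
    rw [sub_im] at h1 h2
    linarith
  rcases hd0.eq_or_lt with h0 | h0
  · rw [← h0, zero_mul]; exact hcap0
  · -- `d² m ≤ |g - z|² m ≤ hcap · d`, divide by `d > 0`
    have h2 : (z.im - (φ z).im) ^ 2 * (φ z).im ≤ hcap K φ * (z.im - (φ z).im) :=
      (mul_le_mul_of_nonneg_right (pow_le_pow_left₀ hd0 hd 2) him.le).trans h
    nlinarith

/-- **High points keep more than half their height**: `Im z/2 < Im g(z)` whenever
`4 hcap < (Im z)²` (`K` a bounded hull). [cite: Lawler2005, §3.4 (3.7) with Thm. 4.6] -/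
theorem half_im_lt_im_of_four_mul_hcap_lt (hK : IsBoundedHull K) (hφ : IsHydrodynamicMap K φ)
    {z : ℂ} (hzi : 0 < z.im) (hz : 4 * hcap K φ < z.im ^ 2) : z.im / 2 < (φ z).im := by
  have hb : IsBounded (K ∩ upperHalfPlaneSet) := hK.1.subset inter_subset_left
  have hcap0 : 0 ≤ hcap K φ := hφ.hcap_nonneg hb
  set a := hcap K φ with ha
  -- the half-plane `R = {Im > 2√a}` lies in `ℍ ∖ K`
  set R : Set ℂ := {ζ : ℂ | 2 * Real.sqrt a < ζ.im} with hR
  have hsq : (2 * Real.sqrt a) ^ 2 = 4 * a := by rw [mul_pow, Real.sq_sqrt hcap0]; norm_num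
  have hRim : ∀ ζ ∈ R, 0 < ζ.im ∧ 4 * a < ζ.im ^ 2 := fun ζ hζ ↦ by
    have h0 : 0 ≤ 2 * Real.sqrt a := by positivity
    have hζ' : 2 * Real.sqrt a < ζ.im := hζ
    refine ⟨h0.trans_lt hζ', ?_⟩
    calc 4 * a = (2 * Real.sqrt a) ^ 2 := hsq.symm
      _ < ζ.im ^ 2 := by gcongr
  have hRsub : R ⊆ upperHalfPlaneSet \ K := fun ζ hζ ↦
    mem_diff_of_two_mul_hcap_lt hK hφ (hRim ζ hζ).1 (by linarith [(hRim ζ hζ).2])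
  have hzR : z ∈ R := by
    show 2 * Real.sqrt a < z.im
    exact lt_of_pow_lt_pow_left₀ 2 hzi.le (by rw [hsq]; exact hz)
  -- `D = 2 Im g - Im` is continuous on `R`, never zero, and positive far up
  set D : ℂ → ℝ := fun ζ ↦ 2 * (φ ζ).im - ζ.im with hD
  have hDc : ContinuousOn D R :=
    ((continuous_im.comp_continuousOn (φ.continuousOn.mono hRsub)).const_smul (2 : ℝ)).sub
      continuous_im.continuousOn |>.congr fun ζ _ ↦ by simp [hD]
  have hDne : ∀ ζ ∈ R, D ζ ≠ 0 := by
    intro ζ hζ hD0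
    have hdm := hφ.sub_im_mul_im_le_hcap hb (hRsub hζ)
    have hm : (φ ζ).im = ζ.im / 2 := by simp only [hD] at hD0; linarith
    rw [hm] at hdm
    nlinarith [(hRim ζ hζ).2]
  -- a point far up where `D > 0`
  obtain ⟨T, hT⟩ : ∃ T : ℝ, ∀ w ∈ upperHalfPlaneSet \ K, T ≤ ‖w‖ → ‖φ w - w‖ < 1 :=
    hφ.exists_forall_norm_sub_lt one_pos
  set y : ℝ := max (max T 0) (2 * Real.sqrt a) + 2 with hy
  have hy2 : 2 * Real.sqrt a + 2 ≤ y := by rw [hy]; linarith [le_max_right (max T 0) (2 * Real.sqrt a)]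
  have hyT : T ≤ y := by
    rw [hy]; linarith [le_max_left T 0, le_max_left (max T 0) (2 * Real.sqrt a)]
  have hy0 : 0 < y := by linarith [Real.sqrt_nonneg a]
  have hIy : (I * (y : ℂ)).im = y := by simp
  have hyR : I * (y : ℂ) ∈ R := by show 2 * Real.sqrt a < (I * (y : ℂ)).im; rw [hIy]; linarith
  have hDy : 0 < D (I * y) := by
    have h1 := hT _ (hRsub hyR) (by
      rw [norm_mul, norm_I, one_mul, norm_real, Real.norm_eq_abs, abs_of_pos hy0]; exact hyT)
    have h2 : y - 1 < (φ (I * y)).im := by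
      have := abs_im_le_norm (φ (I * y) - I * y)
      have := neg_abs_le (φ (I * y) - I * y).im
      rw [sub_im, hIy] at *
      linarith
    simp only [hD, hIy]
    linarith [Real.sqrt_nonneg a]
  -- connectedness: `D` has constant sign on `R`
  have hRconn : IsPreconnected R := (convex_halfSpace_im_gt _).isPreconnected
  have hDz : 0 < D z := by
    by_contra hle
    rw [not_lt] at hle
    have hmem : (0 : ℝ) ∈ Icc (D z) (D (I * y)) := ⟨hle, hDy.le⟩
    obtain ⟨ζ, hζ, hζ0⟩ := hRconn.intermediate_value hzR hyR hDc hmem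
    exact hDne ζ hζ hζ0
  simp only [hD] at hDz
  linarith

/-- **`Im z - 2 hcap/Im z ≤ Im g(z)`** for `4 hcap < (Im z)²` (`K` a bounded hull): the general-hull
form of `(Im g_t(z))² ≥ (Im z)² - 4t`. [cite: Lawler2005, §3.4 (3.7) with Thm. 4.6] -/
theorem im_sub_le_im (hK : IsBoundedHull K) (hφ : IsHydrodynamicMap K φ) {z : ℂ} (hzi : 0 < z.im)
    (hz : 4 * hcap K φ < z.im ^ 2) : z.im - 2 * hcap K φ / z.im ≤ (φ z).im := by
  have hb : IsBounded (K ∩ upperHalfPlaneSet) := hK.1.subset inter_subset_left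
  have hhalf := hφ.half_im_lt_im_of_four_mul_hcap_lt hK hzi hz
  have hdm := hφ.sub_im_mul_im_le_hcap hb (mem_diff_of_two_mul_hcap_lt hK hφ hzi (by
    linarith [hφ.hcap_nonneg hb]))
  -- `d ≤ hcap/m < 2 hcap/Im z`
  have hm : 0 < (φ z).im := by linarith
  have hd : z.im - (φ z).im ≤ hcap K φ / (φ z).im := by rw [le_div_iff₀ hm]; exact hdm
  have h2 : hcap K φ / (φ z).im ≤ 2 * hcap K φ / z.im := by
    rw [div_le_div_iff₀ hm hzi]
    nlinarith [hφ.hcap_nonneg hb]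
  linarith

/-- **`|g(z) - z| ≤ 2 hcap/Im z`** for `4 hcap < (Im z)²` (`K` a bounded hull).
[cite: Lawler2005, §3.4 Prop. 3.36] -/
theorem norm_sub_self_le_two_mul_hcap_div_im (hK : IsBoundedHull K) (hφ : IsHydrodynamicMap K φ)
    {z : ℂ} (hzi : 0 < z.im) (hz : 4 * hcap K φ < z.im ^ 2) :
    ‖φ z - z‖ ≤ 2 * hcap K φ / z.im := by
  have hb : IsBounded (K ∩ upperHalfPlaneSet) := hK.1.subset inter_subset_left
  have hzK := mem_diff_of_two_mul_hcap_lt hK hφ hzi (by linarith [hφ.hcap_nonneg hb])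
  have h1 := hφ.norm_sub_self_le_hcap_div_im hb hzK
  have hhalf := hφ.half_im_lt_im_of_four_mul_hcap_lt hK hzi hz
  refine h1.trans ?_
  rw [div_le_div_iff₀ (by linarith) hzi]
  nlinarith [hφ.hcap_nonneg hb]

/-- **The derivative is close to `1` at high points**: `|g'(z) - 1| ≤ 11 hcap/(Im z)²` for
`16 hcap ≤ (Im z)²` (Cauchy's estimate for `g - id` on `B(z, Im z/4)`, where
`|g - id| ≤ 2 hcap/Im ≤ 8 hcap/(3 Im z)`). [cite: Lawler2005, §3.4 Prop. 3.36] -/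
theorem norm_deriv_sub_one_le (hK : IsBoundedHull K) (hφ : IsHydrodynamicMap K φ) {z : ℂ}
    (hzi : 0 < z.im) (hz : 16 * hcap K φ ≤ z.im ^ 2) :
    ‖deriv φ z - 1‖ ≤ 11 * hcap K φ / z.im ^ 2 := by
  have hb : IsBounded (K ∩ upperHalfPlaneSet) := hK.1.subset inter_subset_left
  have hcap0 := hφ.hcap_nonneg hb
  set r : ℝ := z.im / 4 with hr
  have hr0 : 0 < r := by positivity
  -- the closed disc `B̄(z, Im z/4)` lies in `{4 hcap < Im²} ⊆ ℍ ∖ K`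
  have hball : ∀ ζ ∈ closedBall z r, 0 < ζ.im ∧ 4 * hcap K φ < ζ.im ^ 2 ∧ 3 * z.im / 4 ≤ ζ.im := by
    intro ζ hζ
    rw [mem_closedBall, dist_eq_norm] at hζ
    have h1 : 3 * z.im / 4 ≤ ζ.im := by
      have h1 := neg_abs_le (ζ - z).im
      have h2 := abs_im_le_norm (ζ - z)
      rw [sub_im] at h1 h2
      linarith
    refine ⟨by linarith, ?_, h1⟩
    nlinarith
  have hsub : closedBall z r ⊆ upperHalfPlaneSet \ K := fun ζ hζ ↦
    mem_diff_of_two_mul_hcap_lt hK hφ (hball ζ hζ).1 (by linarith [(hball ζ hζ).2.1])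
  set f : ℂ → ℂ := fun ζ ↦ φ ζ - ζ with hf
  have hfd : DiffContOnCl ℂ f (ball z r) :=
    ((φ.differentiableOn_coe.sub differentiableOn_id).mono hsub).diffContOnCl_ball Subset.rfl
  have hC : ∀ ζ ∈ sphere z r, ‖f ζ‖ ≤ 8 * hcap K φ / (3 * z.im) := by
    intro ζ hζ
    obtain ⟨hζi, hζ4, hζ3⟩ := hball ζ (sphere_subset_closedBall hζ)
    refine (hφ.norm_sub_self_le_two_mul_hcap_div_im hK hζi hζ4).trans ?_
    rw [div_le_div_iff₀ hζi (by positivity)]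
    nlinarith
  have hderiv := Complex.norm_deriv_le_of_forall_mem_sphere_norm_le hr0 hfd hC
  have hfderiv : deriv f z = deriv φ z - 1 := by
    have hφd : DifferentiableAt ℂ φ z :=
      φ.differentiableOn_coe.differentiableAt ((isOpen_diff φ).mem_nhds (hsub (mem_closedBall_self hr0.le)))
    exact (hφd.hasDerivAt.sub (hasDerivAt_id z)).deriv
  rw [hfderiv] at hderiv
  refine hderiv.trans ?_
  rw [hr, div_div, div_le_div_iff₀ (by positivity) (by positivity)]
  nlinarith

/-- **`|log |g'(z)|| ≤ 22 hcap/(Im z)²` for `32 hcap ≤ (Im z)²`** (`K` a bounded hull).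
[cite: Lawler2005, §3.4 Prop. 3.36] -/
theorem abs_log_norm_deriv_le (hK : IsBoundedHull K) (hφ : IsHydrodynamicMap K φ) {z : ℂ}
    (hzi : 0 < z.im) (hz : 32 * hcap K φ ≤ z.im ^ 2) :
    |Real.log ‖deriv φ z‖| ≤ 22 * hcap K φ / z.im ^ 2 := by
  have hb : IsBounded (K ∩ upperHalfPlaneSet) := hK.1.subset inter_subset_left
  have hcap0 := hφ.hcap_nonneg hb
  have h1 := hφ.norm_deriv_sub_one_le hK hzi (by linarith)
  have h2 : |‖deriv φ z‖ - 1| ≤ ‖deriv φ z - 1‖ := by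
    have := abs_norm_sub_norm_le (deriv φ z) 1
    rwa [norm_one] at this
  have h3 : |‖deriv φ z‖ - 1| ≤ 1 / 2 := by
    refine h2.trans (h1.trans ?_)
    rw [div_le_div_iff₀ (by positivity) (by norm_num)]
    nlinarith
  -- `|log x| ≤ 2 |x - 1|` for `|x - 1| ≤ 1/2` (`1 - 1/x ≤ log x ≤ x - 1`)
  have hlog : ∀ x : ℝ, |x - 1| ≤ 1 / 2 → |Real.log x| ≤ 2 * |x - 1| := by
    intro x hx
    have hx1 := abs_le.1 hx
    have hx0 : 0 < x := by linarith
    rw [abs_le]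
    constructor
    · have h4 := Real.one_sub_inv_le_log_of_pos hx0
      have h5 : -(2 * |x - 1|) ≤ 1 - x⁻¹ := by
        rw [show 1 - x⁻¹ = (x - 1) / x by field_simp, le_div_iff₀ hx0]
        have := neg_abs_le (x - 1)
        nlinarith [abs_nonneg (x - 1)]
      linarith
    · linarith [Real.log_le_sub_one_of_pos hx0, le_abs_self (x - 1), abs_nonneg (x - 1)]
  calc |Real.log ‖deriv φ z‖| ≤ 2 * |‖deriv φ z‖ - 1| := hlog _ h3
    _ ≤ 2 * (11 * hcap K φ / z.im ^ 2) := by gcongr; exact h2.trans h1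
    _ = 22 * hcap K φ / z.im ^ 2 := by ring

end IsHydrodynamicMap

end Literature.Probability.RandomPlanarGeometry

end
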